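import Summits.QuantumAdvantage.QuantumAdvantage.Theorems.LinnikCubicClassGroupsDegreeOnePrimesEscapeTatuzawa
import Summits.QuantumAdvantage.QuantumAdvantage.Theorems.LinnikCubicClassGroupsDegreeOnePrimesEscapeResidueUpper
import Mathlib.NumberTheory.Cyclotomic.PrimitiveRoots
import Mathlib.RingTheory.Polynomial.Cyclotomic.Roots
import Mathlib.Data.Nat.Factorization.Induction
import HarnessLib

/-!
# The two-sided Brauer–Siegel theorem at fixed degree with EXPLICIT constants, up to one
# exceptional quadratic field; an explicit bound for the number of roots of unity

Topic `Summits/QuantumAdvantage/QuantumAdvantage/Theorems`, cell B2b-1 (linnik-cubic), PART A (gen 26);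
helper toward the crux `DegreeOnePrimesEscape` (stmt-QuantumAdvantage-11543) of route
`LinnikCubicClassGroups`.  HONEST FRAMING: the value of this file is a THEOREM (kernel-checked, explicit
constants) — NOT summit progress.

The tree's Brauer–Siegel theorem with an additive constant (`Residue.abs_log_classNumber_mul_regulator_sub_le`:
`|log(h_K R_K) − ½ log|d_K|| ≤ ε log|d_K| + C(n,ε)` for every `K` of degree `n`) has an INEFFECTIVE `C`
on both sides: the lower bound through Siegel, the upper bound through a Northcott-type count of the
roots of unity (`exists_torsionOrder_le_of_finrank_le`).  Here both are made explicit: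

* `self_le_two_mul_totient_sq` — `m ≤ 2 φ(m)²` for every `m` (prime powers and coprime multiplicativity);
* `torsionOrder_le_two_mul_finrank_sq` — **`w_K ≤ 2 [K:ℚ]²`** for every number field (`φ(w_K) ≤ [K:ℚ]`
  as `K ⊇ ℚ(ζ_{w_K})`, Mathlib `IsPrimitiveRoot.lcm_totient_le_finrank`);
* `classNumber_mul_regulator_le_explicit` — **`h_K R_K ≤ 4 e^{1/2} n² √|d_K| (log|d_K|)^{n−1}`** for every
  `K` of degree `n > 1` (the tree's `Residue.classNumber_mul_regulator_le_sqrt_mul_log_pow` with the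
  explicit `w_K`), and `log (h_K R_K) ≤ (½ + ε) log|d_K| + log(4e^{1/2}n²) + (n−1) log((n−1)/ε)`;
* `exists_tatuzawa_exceptional_absDiscr_abs_log_sub_le` — **for `0 < ε ≤ 1` there is `M₀ = M₀(ε)` such
  that every number field `K` of degree `n > 1` none of whose quadratic subfields has `|d_k| = M₀`
  satisfies `|log(h_K R_K) − ½ log|d_K|| ≤ ε log|d_K| + B(n,ε)`** with the EXPLICIT
  `B(n,ε) = max (log(4e^{1/2}n²) + (n−1) log((n−1)/ε)) (−log A(n,ε))`,
  `A(n,ε) = e^{-7}16^{-n}(2π)^{-n} C_T ε⁵/(2000·n!)` the constant of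
  `exists_tatuzawa_exceptional_absDiscr_classNumber` — the Brauer–Siegel theorem at fixed degree made
  effective up to one exceptional quadratic field per scale.
[Tatuzawa1951] [Stark1974, §1] [Siegel1935] [Brauer1947 via MontgomeryVaughan2007 Cor. 11.15].  0 sorries.
-/

noncomputable section

open Complex NumberField NumberField.Units Module

namespace Summit.QuantumAdvantage.QuantumAdvantage.Theorems.DegreeOnePrimesEscape

open Literature.NumberTheory.LFunctions Literature.NumberTheory.LFunctions.NumberField
  Literature.NumberTheory.LFunctions.Siegel

/-! ### An explicit lower bound for Euler's totient -/

/-- Prime powers: `p^k ≤ 2 φ(p^k)²`, and `p^k ≤ φ(p^k)²` for odd `p`. [folklore] -/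
theorem prime_pow_le_totient_sq {p k : ℕ} (hp : p.Prime) (hk : 0 < k) :
    p ^ k ≤ 2 * Nat.totient (p ^ k) ^ 2 ∧ (Odd p → p ^ k ≤ Nat.totient (p ^ k) ^ 2) := by
  rw [Nat.totient_prime_pow hp hk]
  have hp2 : 2 ≤ p := hp.two_le
  obtain ⟨j, rfl⟩ : ∃ j, k = j + 1 := ⟨k - 1, by omega⟩
  simp only [Nat.add_sub_cancel]
  have hpj : 1 ≤ p ^ j := Nat.one_le_pow _ _ hp.pos
  constructor
  · -- `p ≤ 2 (p-1)²`, i.e. `(2p − 1)(p − 2) ≥ 0`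
    have h1 : p ≤ 2 * (p - 1) ^ 2 := by
      have : (p - 1) + 1 = p := by omega
      nlinarith [this]
    calc p ^ (j + 1) = p ^ j * p := pow_succ p j
      _ ≤ p ^ j * (2 * (p - 1) ^ 2) := Nat.mul_le_mul_left _ h1
      _ ≤ (p ^ j * p ^ j) * (2 * (p - 1) ^ 2) :=
          Nat.mul_le_mul_right _ (Nat.le_mul_of_pos_right _ (by positivity))
      _ = 2 * (p ^ j * (p - 1)) ^ 2 := by ring
  · intro hodd
    have hp3 : 3 ≤ p := by
      rcases hp.eq_two_or_odd' with h | h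
      · exact absurd hodd (by rw [h]; decide)
      · obtain ⟨m, hm⟩ := h; omega
    have h1 : p ≤ (p - 1) ^ 2 := by
      have : (p - 1) + 1 = p := by omega
      nlinarith [this]
    calc p ^ (j + 1) = p ^ j * p := pow_succ p j
      _ ≤ p ^ j * (p - 1) ^ 2 := Nat.mul_le_mul_left _ h1
      _ ≤ (p ^ j * p ^ j) * (p - 1) ^ 2 :=
          Nat.mul_le_mul_right _ (Nat.le_mul_of_pos_right _ (by positivity))
      _ = (p ^ j * (p - 1)) ^ 2 := by ring

/-- **`m ≤ 2 φ(m)²` for every natural number `m`** (and `m ≤ φ(m)²` for odd `m`), by induction over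
coprime factorisations. [folklore] -/
theorem self_le_two_mul_totient_sq (m : ℕ) :
    m ≤ 2 * Nat.totient m ^ 2 ∧ (Odd m → m ≤ Nat.totient m ^ 2) := by
  induction m using Nat.recOnPosPrimePosCoprime with
  | prime_pow p k hp hk =>
    refine ⟨(prime_pow_le_totient_sq hp hk).1, fun hodd => (prime_pow_le_totient_sq hp hk).2 ?_⟩
    exact (Nat.odd_pow_iff hk.ne').mp hodd
  | zero => simp
  | one => simp
  | coprime a b ha hb hab iha ihb =>
    rw [Nat.totient_mul hab]
    obtain ⟨ha2, hao⟩ := iha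
    obtain ⟨hb2, hbo⟩ := ihb
    constructor
    · -- at most one of `a`, `b` is even
      rcases Nat.even_or_odd a with hae | haodd
      · have hbodd : Odd b := by
          rcases Nat.even_or_odd b with hbe | hbo'
          · exfalso
            have h2 : 2 ∣ Nat.gcd a b := Nat.dvd_gcd (even_iff_two_dvd.mp hae) (even_iff_two_dvd.mp hbe)
            rw [hab] at h2
            omega
          · exact hbo'
        have := hbo hbodd
        calc a * b ≤ (2 * a.totient ^ 2) * b.totient ^ 2 := Nat.mul_le_mul ha2 this
          _ = 2 * (a.totient * b.totient) ^ 2 := by ring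
      · have := hao haodd
        calc a * b ≤ a.totient ^ 2 * (2 * b.totient ^ 2) := Nat.mul_le_mul this hb2
          _ = 2 * (a.totient * b.totient) ^ 2 := by ring
    · intro hodd
      have hao' := hao (Nat.Odd.of_mul_left hodd)
      have hbo' := hbo (Nat.Odd.of_mul_right hodd)
      calc a * b ≤ a.totient ^ 2 * b.totient ^ 2 := Nat.mul_le_mul hao' hbo'
        _ = (a.totient * b.totient) ^ 2 := by ring

/-! ### Explicit bound for the roots of unity of a number field -/

/-- **`w_K ≤ 2 [K:ℚ]²`**: the number of roots of unity of a number field is at most twice the square of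
its degree (`K ⊇ ℚ(ζ_{w_K})`, so `φ(w_K) ≤ [K:ℚ]`, and `w ≤ 2φ(w)²`). [folklore] -/
theorem torsionOrder_le_two_mul_finrank_sq (K : Type*) [Field K] [NumberField K] :
    torsionOrder K ≤ 2 * Module.finrank ℚ K ^ 2 := by
  classical
  obtain ⟨g, hg⟩ := IsCyclic.exists_generator (α := torsion K)
  have hordg : orderOf g = torsionOrder K := orderOf_eq_card_of_forall_mem_zpowers hg
  have hprimU : IsPrimitiveRoot (g : (𝓞 K)ˣ) (torsionOrder K) := by
    rw [← hordg, ← Subgroup.orderOf_coe]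
    exact IsPrimitiveRoot.orderOf _
  have hprimK : IsPrimitiveRoot (((g : (𝓞 K)ˣ) : 𝓞 K) : K) (torsionOrder K) :=
    (IsPrimitiveRoot.coe_units_iff.mpr hprimU).map_of_injective (RingOfIntegers.coe_injective)
  have hφ : (torsionOrder K).totient ≤ Module.finrank ℚ K := by
    have h := IsPrimitiveRoot.lcm_totient_le_finrank (K := ℚ) hprimK hprimK
      (by rw [Nat.lcm_self]; exact Polynomial.cyclotomic.irreducible_rat (torsionOrder_pos K))
    rwa [Nat.lcm_self] at h
  calc torsionOrder K ≤ 2 * (torsionOrder K).totient ^ 2 := (self_le_two_mul_totient_sq _).1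
    _ ≤ 2 * Module.finrank ℚ K ^ 2 := by gcongr

/-! ### The explicit upper bound and the two-sided Brauer–Siegel theorem -/

/-- **Explicit upper bound `h_K R_K ≤ 4e^{1/2} n² √|d_K| (log|d_K|)^{n−1}`** for every number field of
degree `n > 1` (the tree's `Residue.classNumber_mul_regulator_le_sqrt_mul_log_pow`, i.e. Louboutin-type
`κ_K ≤ 2^{n+1}e^{1/2}(log|d_K|)^{n−1}`, combined with `w_K ≤ 2n²`). [cite: Stark1974, §1]
[cite: MontgomeryVaughan2007, Corollary 11.15] -/
theorem classNumber_mul_regulator_le_explicit (K : Type) [Field K] [NumberField K]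
    (hn : 1 < Module.finrank ℚ K) :
    (classNumber K : ℝ) * regulator K ≤
      4 * Real.exp (1 / 2) * (Module.finrank ℚ K : ℝ) ^ 2 * Real.sqrt |(discr K : ℝ)| *
        Real.log |(discr K : ℝ)| ^ (Module.finrank ℚ K - 1) := by
  have h := Residue.classNumber_mul_regulator_le_sqrt_mul_log_pow K hn
  have hw : (torsionOrder K : ℝ) ≤ 2 * (Module.finrank ℚ K : ℝ) ^ 2 := by
    exact_mod_cast torsionOrder_le_two_mul_finrank_sq K
  have hd : (1 : ℝ) ≤ |(discr K : ℝ)| := by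
    have := Int.one_le_abs (discr_ne_zero K)
    exact_mod_cast this
  have hlog : 0 ≤ Real.log |(discr K : ℝ)| := Real.log_nonneg hd
  calc (classNumber K : ℝ) * regulator K
      ≤ 2 * Real.exp (1 / 2) * torsionOrder K * Real.sqrt |(discr K : ℝ)| *
          Real.log |(discr K : ℝ)| ^ (Module.finrank ℚ K - 1) := h
    _ ≤ 2 * Real.exp (1 / 2) * (2 * (Module.finrank ℚ K : ℝ) ^ 2) * Real.sqrt |(discr K : ℝ)| *
          Real.log |(discr K : ℝ)| ^ (Module.finrank ℚ K - 1) := by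
        gcongr
    _ = _ := by ring

/-- `(log d)^{m} ≤ (m/ε)^{m} d^{ε}` for `d ≥ 1`, `ε > 0`, `m ≥ 1` (from `δ log d ≤ d^δ`, `δ = ε/m`). [folklore] -/
theorem log_pow_le_const_mul_rpow {d ε : ℝ} (hd : 1 ≤ d) (hε : 0 < ε) {m : ℕ} (hm : 0 < m) :
    Real.log d ^ m ≤ ((m : ℝ) / ε) ^ m * d ^ ε := by
  have hd0 : 0 < d := by linarith
  have hm0 : (0 : ℝ) < m := by exact_mod_cast hm
  have hlog0 : 0 ≤ Real.log d := Real.log_nonneg hd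
  -- `(ε/m) log d ≤ d^{ε/m}`
  have h1 : ε / m * Real.log d ≤ d ^ (ε / m) := eps_mul_log_le_rpow hd0
  have h2 : Real.log d ≤ (m / ε) * d ^ (ε / m) := by
    rw [div_mul_eq_mul_div, le_div_iff₀ hε]
    calc Real.log d * ε = m * (ε / m * Real.log d) := by field_simp
      _ ≤ m * d ^ (ε / m) := mul_le_mul_of_nonneg_left h1 hm0.le
  calc Real.log d ^ m ≤ ((m / ε) * d ^ (ε / m)) ^ m := pow_le_pow_left₀ hlog0 h2 m
    _ = ((m : ℝ) / ε) ^ m * (d ^ (ε / m)) ^ m := mul_pow _ _ _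
    _ = ((m : ℝ) / ε) ^ m * d ^ ε := by
        rw [← Real.rpow_natCast (d ^ (ε / m)) m, ← Real.rpow_mul hd0.le]
        congr 2; field_simp

/-- **Explicit upper half of Brauer–Siegel**: for every number field `K` of degree `n > 1` and every
`ε > 0`, `log(h_K R_K) ≤ (½ + ε) log|d_K| + log(4e^{1/2}n²) + (n−1)·log((n−1)/ε)` (all quantities
explicit; no exception). [cite: Stark1974, §1] [cite: MontgomeryVaughan2007, Corollary 11.15] -/
theorem log_classNumber_mul_regulator_le_explicit (K : Type) [Field K] [NumberField K]
    (hn : 1 < Module.finrank ℚ K) {ε : ℝ} (hε : 0 < ε) :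
    Real.log ((classNumber K : ℝ) * regulator K) ≤
      (1 / 2 + ε) * Real.log |(discr K : ℝ)| +
        (Real.log (4 * Real.exp (1 / 2) * (Module.finrank ℚ K : ℝ) ^ 2) +
          ((Module.finrank ℚ K : ℝ) - 1) * Real.log (((Module.finrank ℚ K : ℝ) - 1) / ε)) := by
  set n : ℕ := Module.finrank ℚ K with hndef
  set d : ℝ := |(discr K : ℝ)| with hd
  have hd1 : (1 : ℝ) ≤ d := by
    have := Int.one_le_abs (discr_ne_zero K); rw [hd]; exact_mod_cast this
  have hd0 : 0 < d := by linarith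
  have hX0 : 0 < (classNumber K : ℝ) * regulator K := by
    have := regulator_pos K
    have : (0 : ℝ) < classNumber K := by exact_mod_cast classNumber_pos K
    positivity
  have hup := classNumber_mul_regulator_le_explicit K hn
  have hm : 0 < n - 1 := by omega
  have hlogpow := log_pow_le_const_mul_rpow hd1 hε hm
  have hA0 : 0 < 4 * Real.exp (1 / 2) * (n : ℝ) ^ 2 := by
    have : (0 : ℝ) < n := by exact_mod_cast (show 0 < n by omega)
    positivity
  have hcoef0 : 0 < (((n - 1 : ℕ) : ℝ) / ε) ^ (n - 1) := by
    have : (0 : ℝ) < ((n - 1 : ℕ) : ℝ) := by exact_mod_cast hm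
    positivity
  -- `hR ≤ A √d (log d)^{n-1} ≤ A √d ((n-1)/ε)^{n-1} d^ε`
  have hbound : (classNumber K : ℝ) * regulator K ≤
      4 * Real.exp (1 / 2) * (n : ℝ) ^ 2 * (((n - 1 : ℕ) : ℝ) / ε) ^ (n - 1) *
        (Real.sqrt d * d ^ ε) := by
    calc (classNumber K : ℝ) * regulator K
        ≤ 4 * Real.exp (1 / 2) * (n : ℝ) ^ 2 * Real.sqrt d * Real.log d ^ (n - 1) := hup
      _ ≤ 4 * Real.exp (1 / 2) * (n : ℝ) ^ 2 * Real.sqrt d *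
            ((((n - 1 : ℕ) : ℝ) / ε) ^ (n - 1) * d ^ ε) := by gcongr
      _ = _ := by ring
  have hsq : Real.sqrt d * d ^ ε = d ^ (1 / 2 + ε) := by
    rw [Real.sqrt_eq_rpow, ← Real.rpow_add hd0]
  rw [hsq] at hbound
  have hlogle := Real.log_le_log hX0 hbound
  have hcast : ((n - 1 : ℕ) : ℝ) = (n : ℝ) - 1 := by
    rw [Nat.cast_sub (by omega)]; simp
  have hrhs : Real.log (4 * Real.exp (1 / 2) * (n : ℝ) ^ 2 * (((n - 1 : ℕ) : ℝ) / ε) ^ (n - 1) *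
        d ^ (1 / 2 + ε)) =
      Real.log (4 * Real.exp (1 / 2) * (n : ℝ) ^ 2) + ((n : ℝ) - 1) * Real.log (((n : ℝ) - 1) / ε) +
        (1 / 2 + ε) * Real.log d := by
    rw [Real.log_mul (by positivity) (by positivity), Real.log_mul hA0.ne' hcoef0.ne',
      Real.log_rpow hd0, Real.log_pow, hcast]
  rw [hrhs] at hlogle
  linarith

/-- **The Brauer–Siegel theorem at fixed degree with EXPLICIT constants, up to ONE exceptional quadratic
field.**  For `0 < ε ≤ 1` there is `M₀ = M₀(ε) ∈ ℕ` such that every number field `K` of degree `n > 1`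
none of whose quadratic subfields has absolute discriminant `M₀` satisfies
`|log(h_K R_K) − ½ log|d_K|| ≤ ε·log|d_K| + B(n,ε)`, with the EXPLICIT
`B(n,ε) = max (log(4e^{1/2}n²) + (n−1) log((n−1)/ε)) (−log A(n,ε))`,
`A(n,ε) = e^{-7}·16^{-n}·(C_T ε⁵/(1000·n!)/2)/(2π)^n`, `C_T = c_E/(2592 B)` (lower half:
`exists_tatuzawa_exceptional_absDiscr_classNumber`; upper half: `log_classNumber_mul_regulator_le_explicit`).
The exceptional `M₀` is chosen classically; no constant depends on it.
[cite: Tatuzawa1951, Theorem 2] [cite: Stark1974, §1 and Theorem 3] [cite: Siegel1935] -/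
theorem exists_tatuzawa_exceptional_absDiscr_abs_log_sub_le {ε : ℝ} (hε : 0 < ε) (hε1 : ε ≤ 1) :
    ∃ M₀ : ℕ, ∀ (K : Type) [Field K] [NumberField K], 1 < finrank ℚ K →
      (∀ k : IntermediateField ℚ K, finrank ℚ k = 2 → (discr k).natAbs ≠ M₀) →
      |Real.log ((classNumber K : ℝ) * regulator K) - Real.log |(discr K : ℝ)| / 2| ≤
        ε * Real.log |(discr K : ℝ)| +
          max (Real.log (4 * Real.exp (1 / 2) * (finrank ℚ K : ℝ) ^ 2) +
              ((finrank ℚ K : ℝ) - 1) * Real.log (((finrank ℚ K : ℝ) - 1) / ε))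
            (-Real.log (Real.exp (-7) * (1 / 16 : ℝ) ^ finrank ℚ K *
              (Estermann.estermannC / (2592 * ballConst) * ε ^ 5 /
                (1000 * ((finrank ℚ K).factorial : ℝ)) / 2) / (2 * Real.pi) ^ finrank ℚ K)) := by
  obtain ⟨M₀, hM₀⟩ := exists_tatuzawa_exceptional_absDiscr_classNumber hε hε1
  refine ⟨M₀, fun K _ _ hK havoid ↦ ?_⟩
  set n : ℕ := finrank ℚ K with hndef
  set d : ℝ := |(discr K : ℝ)| with hd
  have hd1 : (1 : ℝ) ≤ d := by
    have := Int.one_le_abs (discr_ne_zero K); rw [hd]; exact_mod_cast this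
  have hd0 : 0 < d := by linarith
  have hdnat : ((discr K).natAbs : ℝ) = d := by
    rw [hd, Nat.cast_natAbs, Int.cast_abs]
  have hX0 : 0 < (classNumber K : ℝ) * regulator K := by
    have := regulator_pos K
    have : (0 : ℝ) < classNumber K := by exact_mod_cast classNumber_pos K
    positivity
  -- lower half
  set A : ℝ := Real.exp (-7) * (1 / 16 : ℝ) ^ n *
    (Estermann.estermannC / (2592 * ballConst) * ε ^ 5 / (1000 * (n.factorial : ℝ)) / 2) /
      (2 * Real.pi) ^ n with hA
  have hA0 : 0 < A := by
    have := Estermann.estermannC_pos; have := one_le_ballConst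
    have : (0 : ℝ) < (n.factorial : ℝ) := by exact_mod_cast Nat.factorial_pos n
    positivity
  have hlow := hM₀ K hK havoid
  rw [hdnat] at hlow
  have hlow' : A * d ^ (1 / 2 - ε) ≤ (classNumber K : ℝ) * regulator K := by
    rw [hA]; convert hlow using 1; ring
  have hloglow := Real.log_le_log (by positivity) hlow'
  rw [Real.log_mul hA0.ne' (by positivity), Real.log_rpow hd0] at hloglow
  -- upper half
  have hup := log_classNumber_mul_regulator_le_explicit K hK hε
  -- assemble
  rw [abs_le]
  constructor
  · have : -Real.log A ≤ max (Real.log (4 * Real.exp (1 / 2) * (n : ℝ) ^ 2) +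
        ((n : ℝ) - 1) * Real.log (((n : ℝ) - 1) / ε)) (-Real.log A) := le_max_right _ _
    linarith
  · have : Real.log (4 * Real.exp (1 / 2) * (n : ℝ) ^ 2) + ((n : ℝ) - 1) * Real.log (((n : ℝ) - 1) / ε) ≤
        max (Real.log (4 * Real.exp (1 / 2) * (n : ℝ) ^ 2) + ((n : ℝ) - 1) * Real.log (((n : ℝ) - 1) / ε))
          (-Real.log A) := le_max_left _ _
    linarith

end Summit.QuantumAdvantage.QuantumAdvantage.Theorems.DegreeOnePrimesEscape

end
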